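import Summits.Ventures.HSemireg.WedgeHankelClassSpaceRaisingCharP
import Summits.Ventures.HSemireg.WedgeHankelClassSpaceLowerShearExponential

/-!
# Venture HSemireg — THE LOWERING OPERATOR: `S·f^k·S = e^k`, so `f^k = 0 ↔ e^k = 0`; `f^{n+1} = 0`, `f^n ≠ 0` when `n!` is a unit, and in characteristic `p`
# **`f^p = 0` with nilpotency index exactly `min(p, n+1)`** — the raising and lowering operators have the same nilpotency index over every field

HONEST FRAMING. Part of the Lean index of the computation cell `pub-hsemireg` (seat p10 gen 23, Sunday typer «UNIFORM-IN-n»).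
Finite-dimensional linear algebra of endomorphisms of th-7's class space ONLY: no variety, no cohomology theory, no sheaf, no Ext group, no semiregularity map;
nothing here says that HC / HC_CM / HC_AV holds; no Literature fact is declared or used.  Custodian versions as in `WedgeHankelSiegelIdeal` (1/3) and `WedgeHankelFrameChange`;
the dictionary (`f` = the infinitesimal lower shear on `Sym^n`, `S` = the Weyl element swapping the two letters) is QUOTED, never asserted.

WHAT IS IN THE TREE.  K27 (`WedgeHankelClassSpaceSl2Triple`): the operators `e`, `f` on the spikes (hypotheses `hE`, `hEtop`, `hF`, `hF0`), `raising_pow_succ_eq_zero`,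
`raising_pow_ne_zero_of_factorial`; K31 (`WedgeHankelClassSpaceLowerShearExponential`): `swap_mul_pow_raising_mul_swap` (`S·e^k·S = f^k`); J11 `SbC_swap_mul_swap` (`S² = 1`);
K43 (`WedgeHankelClassSpaceRaisingCharP`): `raising_pow_charP_eq_zero` (`e^p = 0`), `raising_pow_eq_zero_iff_charP` (`e^k = 0 ↔ min p (n+1) ≤ k`).
THIS FILE (namespace `Summit.Ventures.HSemireg.Wedge.HankelFrameChange` continued; imports K43 and K31):
* §368 `swap_mul_pow_lowering_mul_swap` (`S·f^k·S = e^k`), **`lowering_pow_eq_zero_iff_raising_pow_eq_zero`: `f^k = 0 ↔ e^k = 0`** (every field, every `n`, `k`),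
  `lowering_pow_succ_eq_zero` (`f^{n+1} = 0`), `lowering_pow_ne_zero_of_factorial` (`n!` a unit ⇒ `f^n ≠ 0`), `lowering_pow_eq_zero_iff_of_factorial` (`n!` a unit ⇒
  `f^k = 0 ↔ n + 1 ≤ k`) and its `e`-version `raising_pow_eq_zero_iff_of_factorial`.
* §369 characteristic `p`: **`lowering_pow_charP_eq_zero`: `f^p = 0`**, `lowering_pow_ne_zero_of_lt_charP`, and the index **`lowering_pow_eq_zero_iff_charP`:
  `f^k = 0 ↔ min p (n+1) ≤ k`** — the same index as the raising operator (K43).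
NOT typed here: the Jordan types of `e` and `f` (blocks of length `p`; cf. K11/K21 for the shear); anything Ext-side.  New names only.
-/

open Module

namespace Summit.Ventures.HSemireg.Wedge.HankelFrameChange

open Summit.Ventures.HSemireg.Wedge Summit.Ventures.HSemireg.Wedge.Kunneth Summit.Ventures.HSemireg.Wedge.Hankel
  Summit.Ventures.HSemireg.Wedge.BasisFree Summit.Ventures.HSemireg.Wedge.HankelSiegel Summit.Ventures.HSemireg.Wedge.HankelSiegelIdeal
  Summit.Ventures.HSemireg.Wedge.KunnethKernel Summit.Ventures.HSemireg.Wedge.HankelRankOne Summit.Ventures.HSemireg.Wedge.KernelDuality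

variable (K : Type*) [Field K] {n : ℕ}

section Lowering

variable {e f : Module.End K (spikeSpan K n)}
  (hE : ∀ (i : Fin (n + 1)) (hi : (i : ℕ) < n), e (spikeBasis K n i) = (((i : ℕ) : K) + 1) • spikeBasis K n ⟨(i : ℕ) + 1, by omega⟩) (hEtop : e (spikeBasis K n (Fin.last n)) = 0)
  (hF : ∀ (i : Fin (n + 1)) (hi : 0 < (i : ℕ)), f (spikeBasis K n i) = ((n : K) - (i : ℕ) + 1) • spikeBasis K n ⟨(i : ℕ) - 1, by omega⟩) (hF0 : f (spikeBasis K n 0) = 0)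
include hE hEtop hF hF0

/-! ## §368. `f^k` and `e^k` are conjugate under the Weyl element -/

/-- **`S·f^k·S = e^k`** (conjugate `S·e^k·S = f^k` once more; `S² = 1`). -/
theorem swap_mul_pow_lowering_mul_swap (k : ℕ) : SbC K 0 1 1 0 * f ^ k * SbC K 0 1 1 0 = e ^ k := by
  rw [← swap_mul_pow_raising_mul_swap K hE hEtop hF hF0 k, ← mul_assoc, ← mul_assoc, SbC_swap_mul_swap, one_mul, mul_assoc, SbC_swap_mul_swap, mul_one]

/-- **`f^k = 0 ↔ e^k = 0`** (every field, every `n`, every `k`): the two powers are conjugate. -/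
theorem lowering_pow_eq_zero_iff_raising_pow_eq_zero (k : ℕ) : f ^ k = 0 ↔ e ^ k = 0 := by
  constructor
  · intro h
    rw [← swap_mul_pow_lowering_mul_swap K hE hEtop hF hF0 k, h, mul_zero, zero_mul]
  · intro h
    rw [← swap_mul_pow_raising_mul_swap K hE hEtop hF hF0 k, h, mul_zero, zero_mul]

/-- `f^{n+1} = 0` (every field). -/
theorem lowering_pow_succ_eq_zero : f ^ (n + 1) = 0 :=
  (lowering_pow_eq_zero_iff_raising_pow_eq_zero K hE hEtop hF hF0 (n + 1)).mpr (raising_pow_succ_eq_zero K hE hEtop)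

/-- `f^n ≠ 0` when `n!` is a unit in `K`. -/
theorem lowering_pow_ne_zero_of_factorial (hfac : ((n.factorial : ℕ) : K) ≠ 0) : f ^ n ≠ 0 := fun h =>
  raising_pow_ne_zero_of_factorial K hE hfac ((lowering_pow_eq_zero_iff_raising_pow_eq_zero K hE hEtop hF hF0 n).mp h)

omit hF hF0 in
/-- when `n!` is a unit: `e^k = 0 ↔ n + 1 ≤ k` (the nilpotency index of `e` is `n + 1`). -/
theorem raising_pow_eq_zero_iff_of_factorial (hfac : ((n.factorial : ℕ) : K) ≠ 0) (k : ℕ) : e ^ k = 0 ↔ n + 1 ≤ k := by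
  constructor
  · intro h
    by_contra hk
    apply raising_pow_ne_zero_of_factorial K hE hfac
    have hk' : k ≤ n := by omega
    calc e ^ n = e ^ (n - k) * e ^ k := by rw [← pow_add, Nat.sub_add_cancel hk']
      _ = 0 := by rw [h, mul_zero]
  · intro hk
    rw [← Nat.sub_add_cancel hk, pow_add, raising_pow_succ_eq_zero K hE hEtop, mul_zero]

/-- when `n!` is a unit: `f^k = 0 ↔ n + 1 ≤ k` (the nilpotency index of `f` is `n + 1`). -/
theorem lowering_pow_eq_zero_iff_of_factorial (hfac : ((n.factorial : ℕ) : K) ≠ 0) (k : ℕ) : f ^ k = 0 ↔ n + 1 ≤ k := by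
  rw [lowering_pow_eq_zero_iff_raising_pow_eq_zero K hE hEtop hF hF0 k, raising_pow_eq_zero_iff_of_factorial K hE hEtop hfac k]

/-! ## §369. The lowering operator in characteristic `p` -/

/-- **`f ^ p = 0` in characteristic `p`** (every `n`). -/
theorem lowering_pow_charP_eq_zero (p : ℕ) [Fact p.Prime] [CharP K p] : f ^ p = 0 :=
  (lowering_pow_eq_zero_iff_raising_pow_eq_zero K hE hEtop hF hF0 p).mpr (raising_pow_charP_eq_zero K hE hEtop p)

/-- in characteristic `p`, `f^k ≠ 0` for `k ≤ n` with `k < p`. -/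
theorem lowering_pow_ne_zero_of_lt_charP (p : ℕ) [Fact p.Prime] [CharP K p] {k : ℕ} (hkn : k ≤ n) (hkp : k < p) : f ^ k ≠ 0 := fun h =>
  raising_pow_ne_zero_of_lt_charP K hE p hkn hkp ((lowering_pow_eq_zero_iff_raising_pow_eq_zero K hE hEtop hF hF0 k).mp h)

/-- **THE NILPOTENCY INDEX OF THE LOWERING OPERATOR IN CHARACTERISTIC `p` IS `min(p, n+1)`: `f ^ k = 0 ↔ min p (n+1) ≤ k`** (every `n`, every `k`) — the same as for `e` (K43). -/
theorem lowering_pow_eq_zero_iff_charP (p : ℕ) [Fact p.Prime] [CharP K p] (k : ℕ) : f ^ k = 0 ↔ min p (n + 1) ≤ k := by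
  rw [lowering_pow_eq_zero_iff_raising_pow_eq_zero K hE hEtop hF hF0 k, raising_pow_eq_zero_iff_charP K hE hEtop p k]

end Lowering

end Summit.Ventures.HSemireg.Wedge.HankelFrameChange
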